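import Literature.NumberTheory.DiophantineGeometry.SuperellipticHeightsT
import HarnessLib

/-!
# Weil height of the noncritical coordinates `t_c = 1/r + c·r^{m'}/s` on `r^e = x(1-x)`

[GenEll] = S. Mochizuki, *Arithmetic elliptic curves in general position*, Math. J. Okayama Univ. 52
(2010); abc-iut cell, route item `Summit.ABC.ABC.Theses.IUTThetaPilot.GenEllTwo`, S6's plan
GENELLTWO-P1ROUTE v2 §4 (per-configuration protection with the FAMILY `t_c`, ruling #6, amendment
(1)), package W4a, `c`-parametric twin of `SuperellipticHeightsT.lean`. On `D_e : r^e = x(1-x)`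
(`e ≥ 2`, `e + 1 = 2m'`, `s = 1 - 2x`) every `t_c := 1/r + c·r^{m'}/s` (`c ≠ 0`) has the polar divisor
`Q_0 + Q_1 + Q_∞ + Σ_k W_k` of `t = t_1`, so `e·(t_c)_∞ ∼ (e+3)·(x)_∞` ([GenEll] Prop. 1.4 (i), (iii)).
PROVED, convention-free on elements of a number field, with the dependence on `c` explicit:
* `tSumC_lower(_of_isNonarchimedean)` — disjoint polar parts of `t₁ = 1/r` and `c·t₂ = c·r^{m'}/s`:
  `max(v t₁,1)·max(v(c t₂),1) ≤ C_v·max(v(t₁ + c t₂),1)·max(v c,1)²`, `C_v = 32` resp. `1` (`v` finite);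
* `exists_abs_logHeight₁_tFunC_sub_le` — **`|e·h_K(t_c) − (e+3)·h_K(x)| ≤ C(e)·[K:ℚ] + 3e·h_K(c)`**;
* `exists_abs_logHeight₁_tFunC_sub_le_of_rat`, `exists_tFunC_le_of_rat` — `c = q ∈ ℚ^×` fixed:
  bound `C(e,q)·[K:ℚ]`, and the one-sided `(2k+1)·h(t_c) ≤ (2k+4)·h(x) + [L:ℚ]·C₄` shape (`e = 2k+1`)
  consumed as `ht` by `FibreConductor.inv_finrank_mul_sum_logNorm_le_slope` (W5d).
Inputs by name: `Superelliptic.exists_abs_logHeight₁_root_sub_le`, `…_tPart_sub_le`,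
`Superelliptic.mulHeight₁_prod_le_prod_of_forall_absValue`, `NumberField.logHeight₁_algebraMap`.
Everything is proved; no definitions, no named facts; classical height theory — nothing here refers
to the disputed parts of the abc-iut corpus.
-/

noncomputable section

open Height Height.AdmissibleAbsValues Finset Real NumberField
open Literature.NumberTheory.Transcendental

namespace Literature.NumberTheory.DiophantineGeometry

namespace Superelliptic

/-! ### Local analysis: disjoint polar parts of `1/r` and `c·r^{m'}/s` -/

section Local

variable {K : Type*} [Field K] (v : AbsoluteValue K ℝ)

variable {e m' : ℕ}

/-- At a non-archimedean `v`: on `r^e = x(1-x)` (`e ≥ 1`), `v r < 1` forces `v(1 - 2x) = 1`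
(the point is `v`-adically close to `Q_0` or `Q_1`, where `s = ±1`).
[cite: MochizukiGenEll2010, Prop 1.4 (i) p.6] -/
private theorem absValue_s_eq_one_of_absValue_r_lt_one (hv : IsNonarchimedean v) (he : 0 < e)
    {x r : K} (hr : r ^ e = x * (1 - x)) (hR1 : v r < 1) : v (1 - 2 * x) = 1 := by
  -- adapted from L6-t16's `Superelliptic.tSum_lower_of_isNonarchimedean` (key step)
  have hv2' : v (2 : K) ≤ 1 := by exact_mod_cast hv.apply_natCast_le_one (n := 2)
  have hR0 : 0 ≤ v r := v.nonneg _
  have hRe : v r ^ e = v x * v (1 - x) := by rw [← v.map_pow, hr, v.map_mul]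
  have hRe1 : v x * v (1 - x) < 1 := by rw [← hRe]; exact pow_lt_one₀ hR0 hR1 he.ne'
  rcases lt_trichotomy (v x) 1 with hX1 | hX1 | hX1
  · have h2x : v (2 * x) < 1 := by
      rw [v.map_mul]; exact lt_of_le_of_lt (mul_le_of_le_one_left (v.nonneg _) hv2') hX1
    have hne : v (1 : K) ≠ v (-(2 * x)) := by rw [v.map_one, v.map_neg]; exact h2x.ne'
    rw [sub_eq_add_neg, hv.add_eq_max_of_ne hne, v.map_one, v.map_neg, max_eq_left h2x.le]
  · have h1x : v (1 - x) < 1 := by rwa [hX1, one_mul] at hRe1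
    have hlt : v (2 * (1 - x)) < v (-1 : K) := by
      rw [v.map_neg, v.map_one, v.map_mul]
      exact lt_of_le_of_lt (mul_le_of_le_one_left (v.nonneg _) hv2') h1x
    have h' : (1 : K) - 2 * x = -1 + 2 * (1 - x) := by ring
    rw [h', hv.add_eq_max_of_ne (ne_of_gt hlt), max_eq_left hlt.le, v.map_neg, v.map_one]
  · have h1x : v (1 - x) = v x := by
      have hne : v (1 : K) ≠ v (-x) := by rw [v.map_one, v.map_neg]; exact ne_of_lt hX1
      rw [sub_eq_add_neg, hv.add_eq_max_of_ne hne, v.map_one, v.map_neg, max_eq_right hX1.le]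
    rw [h1x] at hRe1
    exact absurd (hRe1.trans (one_lt_mul_of_lt_of_le hX1 hX1.le)) (lt_irrefl _)

/-- **Disjoint polar parts of `t₁ = 1/r` and `c·t₂ = c·r^{m'}/s`, non-archimedean form**
(`r^e = x(1-x)`, `e ≥ 1`, `e + 1 = 2m'`, any `c`): `max(v t₁,1)·max(v(c t₂),1) ≤ max(v(t₁ + c t₂),1)·
max(v c,1)²` — if `v t₁ > 1` then `v s = 1`, `v t₂ ≤ v r < 1`, and either `v(c t₂) < v t₁` (no
cancellation) or `v c ≥ (v t₁)²`. [cite: MochizukiGenEll2010, Prop 1.4 (i) p.6] -/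
theorem tSumC_lower_of_isNonarchimedean (hv : IsNonarchimedean v) (hem : e + 1 = 2 * m')
    (he : 0 < e) {x r : K} (c : K) (hr : r ^ e = x * (1 - x)) (hr0 : r ≠ 0)
    (hs : 1 - 2 * x ≠ 0) :
    max (v r⁻¹) 1 * max (v (c * (r ^ m' / (1 - 2 * x)))) 1 ≤
      max (v (r⁻¹ + c * (r ^ m' / (1 - 2 * x)))) 1 * max (v c) 1 ^ 2 := by
  set S := v (1 - 2 * x) with hS
  set R := v r with hR
  set T := v (r ^ m' / (1 - 2 * x)) with hT
  set γ := v c with hγ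
  set b := v (c * (r ^ m' / (1 - 2 * x))) with hb
  set W := max (v (r⁻¹ + c * (r ^ m' / (1 - 2 * x)))) 1 with hW
  set G := max γ 1 with hG
  have hR0 : 0 < R := v.pos_iff.mpr hr0
  have hS0 : 0 < S := v.pos_iff.mpr hs
  have hγ0 : 0 ≤ γ := v.nonneg _
  have hT0 : 0 ≤ T := v.nonneg _
  have hb0 : 0 ≤ b := v.nonneg _
  have hm'1 : 1 ≤ m' := by omega
  have ha' : v r⁻¹ = R⁻¹ := map_inv₀ v r
  have ha0 : 0 < v r⁻¹ := by rw [ha']; positivity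
  have hbγ : b = γ * T := by rw [hb, v.map_mul]
  have hTdef : T = R ^ m' / S := by rw [hT, map_div₀, v.map_pow]
  have hG1 : 1 ≤ G := le_max_right _ _
  have hγG : γ ≤ G := le_max_left _ _
  have hG2 : G ≤ G ^ 2 := by
    rw [sq]; exact le_mul_of_one_le_right (zero_le_one.trans hG1) hG1
  have hW1 : 1 ≤ W := le_max_right _ _
  have hWv : v (r⁻¹ + c * (r ^ m' / (1 - 2 * x))) ≤ W := le_max_left _ _
  have hWG1 : 1 ≤ W * G ^ 2 := one_le_mul_of_one_le_of_one_le hW1 (one_le_pow₀ hG1)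
  rcases lt_or_ge R 1 with hR1 | hR1
  · -- near `Q_0`/`Q_1`: `v t₁ > 1`, `v s = 1`, `v t₂ ≤ v r < 1`
    have hS1 : S = 1 := absValue_s_eq_one_of_absValue_r_lt_one v hv he hr hR1
    have hTR : T = R ^ m' := by rw [hTdef, hS1, div_one]
    have hT1 : T < 1 := by rw [hTR]; exact pow_lt_one₀ hR0.le hR1 (by omega)
    have hTleR : T ≤ R := by
      rw [hTR]; exact (pow_le_pow_of_le_one hR0.le hR1.le hm'1).trans (pow_one R).le
    have ha1 : 1 < v r⁻¹ := by rw [ha']; exact one_lt_inv_iff₀.mpr ⟨hR0, hR1⟩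
    rw [max_eq_left ha1.le]
    rcases lt_or_ge b (v r⁻¹) with hba | hba
    · -- no cancellation
      have hne : v r⁻¹ ≠ v (c * (r ^ m' / (1 - 2 * x))) := ne_of_gt hba
      have hsum : v (r⁻¹ + c * (r ^ m' / (1 - 2 * x))) = v r⁻¹ := by
        rw [hv.add_eq_max_of_ne hne, max_eq_left hba.le]
      have hWa : v r⁻¹ ≤ W := by rw [← hsum]; exact hWv
      have hb1 : max b 1 ≤ G := by
        refine max_le ?_ hG1
        rw [hbγ]; exact ((mul_le_mul_of_nonneg_left hT1.le hγ0).trans (mul_one γ).le).trans hγG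
      calc v r⁻¹ * max b 1 ≤ W * G := mul_le_mul hWa hb1 (by positivity) (by positivity)
        _ ≤ W * G ^ 2 := mul_le_mul_of_nonneg_left hG2 (by positivity)
    · -- `v(c t₂) ≥ v t₁ > 1`: then `(v t₁)² ≤ v c`
      have hb1 : 1 < b := lt_of_lt_of_le ha1 hba
      rw [max_eq_left hb1.le]
      have haa : v r⁻¹ * v r⁻¹ ≤ γ := by
        have h1 : v r⁻¹ ≤ γ * R :=
          hba.trans (by rw [hbγ]; exact mul_le_mul_of_nonneg_left hTleR hγ0)
        calc v r⁻¹ * v r⁻¹ ≤ γ * R * v r⁻¹ := mul_le_mul_of_nonneg_right h1 ha0.le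
          _ = γ := by rw [ha', mul_assoc, mul_inv_cancel₀ hR0.ne', mul_one]
      have haa1 : 1 < v r⁻¹ * v r⁻¹ := one_lt_mul_of_lt_of_le ha1 ha1.le
      have hγ1 : 1 < γ := haa1.trans_le haa
      have hGγ : G = γ := max_eq_left hγ1.le
      have hγ2 : γ ≤ γ ^ 2 := by rw [sq]; exact le_mul_of_one_le_right hγ0 hγ1.le
      rcases lt_or_eq_of_le hba with hba' | hba'
      · have hne : v r⁻¹ ≠ v (c * (r ^ m' / (1 - 2 * x))) := ne_of_lt hba'
        have hsum : v (r⁻¹ + c * (r ^ m' / (1 - 2 * x))) = b := by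
          rw [hv.add_eq_max_of_ne hne, max_eq_right hba'.le]
        have hWb : b ≤ W := by rw [← hsum]; exact hWv
        have haG : v r⁻¹ ≤ G ^ 2 := by
          rw [hGγ]
          calc v r⁻¹ ≤ v r⁻¹ * v r⁻¹ := le_mul_of_one_le_right ha0.le ha1.le
            _ ≤ γ := haa
            _ ≤ γ ^ 2 := hγ2
        calc v r⁻¹ * b = b * v r⁻¹ := mul_comm _ _
          _ ≤ W * G ^ 2 := mul_le_mul hWb haG ha0.le (by positivity)
      · rw [← hba']
        calc v r⁻¹ * v r⁻¹ ≤ γ := haa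
          _ ≤ γ ^ 2 := hγ2
          _ = 1 * G ^ 2 := by rw [hGγ, one_mul]
          _ ≤ W * G ^ 2 := mul_le_mul_of_nonneg_right hW1 (by positivity)
  · -- `v t₁ ≤ 1`
    have ha1 : v r⁻¹ ≤ 1 := by rw [ha']; exact inv_le_one_of_one_le₀ hR1
    rw [max_eq_right ha1, one_mul]
    rcases le_or_gt b 1 with hb1 | hb1
    · rw [max_eq_right hb1]; exact hWG1
    · have hne : v r⁻¹ ≠ v (c * (r ^ m' / (1 - 2 * x))) := ne_of_lt (ha1.trans_lt hb1)
      have hsum : v (r⁻¹ + c * (r ^ m' / (1 - 2 * x))) = b := by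
        rw [hv.add_eq_max_of_ne hne, max_eq_right (ha1.trans hb1.le)]
      have hWb : b ≤ W := by rw [← hsum]; exact hWv
      rw [max_eq_left hb1.le]
      exact (mul_one b).symm.le.trans (mul_le_mul hWb (one_le_pow₀ hG1) zero_le_one (by positivity))

/-- **Disjoint polar parts of `t₁ = 1/r` and `c·t₂ = c·r^{m'}/s`, any absolute value**
(`r^e = x(1-x)`, `e ≥ 2`, `e + 1 = 2m'`, any `c`): `max(v t₁,1)·max(v(c t₂),1) ≤ 32·max(v(t₁ + c t₂),1)·
max(v c,1)²` — `v t₁ ≥ 4` forces `v t₂ ≤ 1/2`, so `v(c t₂) ≤ max(v c,1)/2` cannot cancel `v t₁` unless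
`v t₁ < max(v c,1)`; `v(c t₂) ≥ 8` forces `v t₁ < 4`. [cite: MochizukiGenEll2010, Prop 1.4 (i) p.6] -/
theorem tSumC_lower (hem : e + 1 = 2 * m') (he : 2 ≤ e) {x r : K} (c : K)
    (hr : r ^ e = x * (1 - x)) (hr0 : r ≠ 0) (hs : 1 - 2 * x ≠ 0) :
    max (v r⁻¹) 1 * max (v (c * (r ^ m' / (1 - 2 * x)))) 1 ≤
      32 * (max (v (r⁻¹ + c * (r ^ m' / (1 - 2 * x)))) 1 * max (v c) 1 ^ 2) := by
  set X := v x with hX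
  set S := v (1 - 2 * x) with hS
  set R := v r with hR
  set T := v (r ^ m' / (1 - 2 * x)) with hT
  set γ := v c with hγ
  set b := v (c * (r ^ m' / (1 - 2 * x))) with hb
  set W := max (v (r⁻¹ + c * (r ^ m' / (1 - 2 * x)))) 1 with hW
  set G := max γ 1 with hG
  have hX0 : 0 ≤ X := v.nonneg _
  have hR0 : 0 < R := v.pos_iff.mpr hr0
  have hS0 : 0 < S := v.pos_iff.mpr hs
  have hT0 : 0 ≤ T := v.nonneg _
  have hγ0 : 0 ≤ γ := v.nonneg _
  have hb0 : 0 ≤ b := v.nonneg _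
  have hv2le : v (2 : K) ≤ 2 := by exact_mod_cast v.apply_nat_le_self 2
  have hv20 : 0 ≤ v (2 : K) := v.nonneg _
  have hm'1 : 1 ≤ m' := by omega
  have ht1 : v r⁻¹ = R⁻¹ := map_inv₀ v r
  have ha0 : 0 < v r⁻¹ := by rw [ht1]; positivity
  have hbγ : b = γ * T := by rw [hb, v.map_mul]
  have hTdef : T = R ^ m' / S := by rw [hT, map_div₀, v.map_pow]
  have hRe : R ^ e = X * v (1 - x) := by rw [hR, ← v.map_pow, hr, v.map_mul]
  have hG1 : 1 ≤ G := le_max_right _ _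
  have hγG : γ ≤ G := le_max_left _ _
  have hG2 : G ≤ G ^ 2 := by
    rw [sq]; exact le_mul_of_one_le_right (zero_le_one.trans hG1) hG1
  have hW1 : 1 ≤ W := le_max_right _ _
  have hWv : v (r⁻¹ + c * (r ^ m' / (1 - 2 * x))) ≤ W := le_max_left _ _
  have hWG1 : 1 ≤ W * G ^ 2 := one_le_mul_of_one_le_of_one_le hW1 (one_le_pow₀ hG1)
  have hbG : b ≤ G * T := by rw [hbγ]; exact mul_le_mul_of_nonneg_right hγG hT0
  -- reverse triangle inequalities
  have hsum1 : v r⁻¹ - b ≤ W := (v.le_add _ _).trans hWv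
  have hsum2 : b - v r⁻¹ ≤ W := (add_comm r⁻¹ _ ▸ v.le_add (c * (r ^ m' / (1 - 2 * x))) r⁻¹).trans hWv
  -- key: `R ≤ 1/4 ⟹ T ≤ 1/2` (adapted from L6-t16's `Superelliptic.tSum_lower`)
  have hkey : R ≤ 1 / 4 → T ≤ 1 / 2 := by
    intro hR4
    have hR1 : R ≤ 1 := hR4.trans (by norm_num)
    have hRe16 : X * v (1 - x) ≤ 1 / 16 := by
      rw [← hRe]
      calc R ^ e ≤ R ^ 2 := pow_le_pow_of_le_one hR0.le hR1 he
        _ ≤ (1 / 4) ^ 2 := pow_le_pow_left₀ hR0.le hR4 2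
        _ = 1 / 16 := by norm_num
    have hS12 : 1 / 2 ≤ S := by
      rcases le_or_gt X (1 / 4) with hX4 | hX4
      · have h := v.le_sub 1 (2 * x)
        rw [v.map_one, v.map_mul] at h
        have h2X : v 2 * v x ≤ 2 * (1 / 4) := mul_le_mul hv2le hX4 hX0 (by norm_num)
        rw [hS]; linarith
      · have h1x : v (1 - x) < 1 / 4 := by
          by_contra hcon
          push Not at hcon
          have h3 : (1 / 4 : ℝ) * (1 / 4) < X * (1 / 4) := by linarith
          have h4 : X * (1 / 4) ≤ X * v (1 - x) := mul_le_mul_of_nonneg_left hcon hX0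
          linarith
        have h := v.le_sub 1 (2 * (1 - x))
        rw [v.map_one, v.map_mul, show (1 : K) - 2 * (1 - x) = -(1 - 2 * x) by ring,
          v.map_neg] at h
        have h2X : v 2 * v (1 - x) ≤ 2 * (1 / 4) := mul_le_mul hv2le h1x.le (v.nonneg _) (by norm_num)
        rw [hS]; linarith
    have hRm : R ^ m' ≤ R := (pow_le_pow_of_le_one hR0.le hR1 hm'1).trans (pow_one R).le
    rw [hTdef, div_le_iff₀ hS0]
    linarith
  rcases le_or_gt R (1 / 4) with hR4 | hR4
  · -- `v t₁ ≥ 4`, `v t₂ ≤ 1/2`, `v(c t₂) ≤ G/2`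
    have hT12 : T ≤ 1 / 2 := hkey hR4
    have ht14 : 4 ≤ v r⁻¹ := by
      rw [ht1, le_inv_comm₀ (by norm_num) hR0]; linarith
    have hbG2 : b ≤ G / 2 := by
      have h := mul_le_mul_of_nonneg_left hT12 (zero_le_one.trans hG1)
      linarith
    have hmaxb : max b 1 ≤ G := max_le (by linarith) hG1
    rw [max_eq_left (by linarith : (1 : ℝ) ≤ v r⁻¹)]
    rcases le_or_gt G (v r⁻¹) with hGa | hGa
    · -- `W ≥ v t₁ - v(c t₂) ≥ v t₁ / 2`
      have hWa : v r⁻¹ ≤ 2 * W := by linarith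
      calc v r⁻¹ * max b 1 ≤ (2 * W) * G := mul_le_mul hWa hmaxb (by positivity) (by positivity)
        _ = 2 * (W * G) := by ring
        _ ≤ 32 * (W * G ^ 2) := by
          have hWG : W * G ≤ W * G ^ 2 := mul_le_mul_of_nonneg_left hG2 (zero_le_one.trans hW1)
          linarith
    · calc v r⁻¹ * max b 1 ≤ G * G := mul_le_mul hGa.le hmaxb (by positivity) (by positivity)
        _ = 1 * G ^ 2 := by ring
        _ ≤ W * G ^ 2 := mul_le_mul_of_nonneg_right hW1 (by positivity)
        _ ≤ 32 * (W * G ^ 2) := by linarith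
  · -- `v t₁ < 4`
    have ht14 : v r⁻¹ < 4 := by
      rw [ht1, inv_lt_comm₀ hR0 (by norm_num)]; linarith
    have hmax4 : max (v r⁻¹) 1 ≤ 4 := max_le ht14.le (by norm_num)
    rcases le_or_gt 8 b with hb8 | hb8
    · have hWb : b ≤ 2 * W := by linarith
      rw [max_eq_left (by linarith : (1 : ℝ) ≤ b)]
      calc max (v r⁻¹) 1 * b ≤ 4 * (2 * W) := mul_le_mul hmax4 hWb hb0 (by norm_num)
        _ = 8 * (W * 1) := by ring
        _ ≤ 8 * (W * G ^ 2) := by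
          have h1 : W * 1 ≤ W * G ^ 2 :=
            mul_le_mul_of_nonneg_left (one_le_pow₀ hG1) (zero_le_one.trans hW1)
          linarith
        _ ≤ 32 * (W * G ^ 2) := by linarith
    · have hmaxb : max b 1 ≤ 8 := max_le hb8.le (by norm_num)
      calc max (v r⁻¹) 1 * max b 1 ≤ 4 * 8 := mul_le_mul hmax4 hmaxb (by positivity) (by norm_num)
        _ ≤ 32 * (W * G ^ 2) := by linarith

end Local

/-! ### Global statement -/

section NumberField

/-- **`|e·h_K(1/r + c·r^{m'}/(1-2x)) − (e+3)·h_K(x)| ≤ C·[K:ℚ] + 3e·h_K(c)`** for every number field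
`K` and `x, r, c ∈ K` with `r^e = x(1-x)`, `x ∉ {0, 1, 1/2}`, `c ≠ 0` (`e ≥ 2`, `e + 1 = 2m'`),
`C = C(e)`: the Weil height of `t_c = 1/r + c·r^{m'}/s` compares with `h(x)` with the sharp slope
`(e+3)/e`, uniformly in `c` up to `h(c)` — [GenEll] Prop. 1.4 (i), (iii) for `t_c, x : D_e → ℙ¹`;
`c = 1` is L6-t16's `exists_abs_logHeight₁_tFun_sub_le`. [cite: MochizukiGenEll2010, Prop 1.4 (i) p.6] -/
theorem exists_abs_logHeight₁_tFunC_sub_le {e m' : ℕ} (he : 2 ≤ e) (hem : e + 1 = 2 * m') :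
    ∃ C : ℝ, ∀ (K : Type) [Field K] [NumberField K] (x r c : K), r ^ e = x * (1 - x) →
      x ≠ 0 → x ≠ 1 → 1 - 2 * x ≠ 0 → c ≠ 0 →
      |(e : ℝ) * logHeight₁ (r⁻¹ + c * (r ^ m' / (1 - 2 * x))) - (e + 3) * logHeight₁ x| ≤
        C * Module.finrank ℚ K + 3 * e * logHeight₁ c := by
  have he0 : 0 < e := by omega
  obtain ⟨C₁, hC₁⟩ := exists_abs_logHeight₁_root_sub_le he0
  obtain ⟨C₂, hC₂⟩ := exists_abs_logHeight₁_tPart_sub_le he0 hem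
  refine ⟨C₁ + C₂ + e * Real.log 32 + e * Real.log 2, ?_⟩
  intro K _ _ x r c hr hx0 hx1 hs hc
  have hr0 : r ≠ 0 := by
    intro h
    rw [h, zero_pow he0.ne'] at hr
    exact mul_ne_zero hx0 (sub_ne_zero.mpr (Ne.symm hx1)) hr.symm
  set t₁ := r⁻¹ with ht₁
  set t₂ := r ^ m' / (1 - 2 * x) with ht₂
  have htw : (totalWeight K : ℝ) = Module.finrank ℚ K := by rw [totalWeight_eq_finrank]
  have hK0 : (0 : ℝ) ≤ Module.finrank ℚ K := Nat.cast_nonneg _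
  have heR : (0 : ℝ) ≤ e := Nat.cast_nonneg _
  have hc0 : 0 ≤ logHeight₁ c := zero_le_logHeight₁ c
  -- `h(t₁) = h(r)` and the two instances
  have ht₁h : logHeight₁ t₁ = logHeight₁ r := logHeight₁_inv r
  have h1 := hC₁ K x r hr
  have h2' := hC₂ K x r hr hs
  rw [abs_le] at h1 h2'
  -- `|h(c t₂) - h(t₂)| ≤ h(c)`
  have hct_up : logHeight₁ (c * t₂) ≤ logHeight₁ c + logHeight₁ t₂ := logHeight₁_mul_le c t₂
  have hct_low : logHeight₁ t₂ ≤ logHeight₁ c + logHeight₁ (c * t₂) := by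
    have h := logHeight₁_mul_le c⁻¹ (c * t₂)
    rwa [logHeight₁_inv, inv_mul_cancel_left₀ hc] at h
  -- additivity, lower: `H(t₁)·H(c t₂) ≤ 32^{tw}·H(t₁ + c t₂)·H(c)²`
  have hadd : mulHeight₁ t₁ * mulHeight₁ (c * t₂) ≤
      (32 : ℝ) ^ totalWeight K * (mulHeight₁ (t₁ + c * t₂) * mulHeight₁ c ^ 2) := by
    have h := mulHeight₁_prod_le_prod_of_forall_absValue (K := K) (univ : Finset (Fin 2))
      (univ : Finset (Fin 2)) (x := ![t₁, c * t₂]) (e := ![1, 1]) (y := ![t₁ + c * t₂, c])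
      (a := ![1, 2]) (C := (32 : ℝ))
      (fun v _ => by simpa only [Fin.prod_univ_succ, Fin.prod_univ_zero, Matrix.cons_val_zero,
        Matrix.cons_val_succ, mul_one, pow_one] using tSumC_lower v hem he c hr hr0 hs)
      (fun v hv => by simpa only [Fin.prod_univ_succ, Fin.prod_univ_zero, Matrix.cons_val_zero,
        Matrix.cons_val_succ, mul_one, pow_one] using
          tSumC_lower_of_isNonarchimedean v (isNonarchimedean v hv) hem he0 c hr hr0 hs)
    simpa only [Fin.prod_univ_succ, Fin.prod_univ_zero, Matrix.cons_val_zero, Matrix.cons_val_succ,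
      mul_one, pow_one] using h
  have haddlog : logHeight₁ t₁ + logHeight₁ (c * t₂) ≤
      Module.finrank ℚ K * Real.log 32 + logHeight₁ (t₁ + c * t₂) + 2 * logHeight₁ c := by
    have hlog := Real.log_le_log (mul_pos (mulHeight₁_pos _) (mulHeight₁_pos _)) hadd
    rw [Real.log_mul (mulHeight₁_pos _).ne' (mulHeight₁_pos _).ne',
      Real.log_mul (by positivity) (by positivity),
      Real.log_mul (mulHeight₁_pos _).ne' (by positivity), Real.log_pow, Real.log_pow, htw] at hlog
    simp only [logHeight₁_eq_log_mulHeight₁]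
    push_cast at hlog ⊢
    linarith
  -- additivity, upper
  have haddup : logHeight₁ (t₁ + c * t₂) ≤
      Module.finrank ℚ K * Real.log 2 + logHeight₁ t₁ + logHeight₁ (c * t₂) := by
    have h := logHeight₁_add_le t₁ (c * t₂)
    rwa [htw] at h
  rw [ht₁h] at haddlog haddup
  have hm1 := mul_le_mul_of_nonneg_left haddlog heR
  have hm2 := mul_le_mul_of_nonneg_left haddup heR
  have hm3 := mul_le_mul_of_nonneg_left hct_up heR
  have hm4 := mul_le_mul_of_nonneg_left hct_low heR
  have hl2 : 0 ≤ Real.log 2 := Real.log_nonneg (by norm_num)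
  have hl32 : 0 ≤ Real.log 32 := Real.log_nonneg (by norm_num)
  have hp1 : 0 ≤ (e : ℝ) * Real.log 2 * Module.finrank ℚ K := by positivity
  have hp2 : 0 ≤ (e : ℝ) * Real.log 32 * Module.finrank ℚ K := by positivity
  have hp3 : 0 ≤ (e : ℝ) * logHeight₁ c := by positivity
  rw [abs_le]
  constructor
  · linarith [h1.1, h1.2, h2'.1, h2'.2]
  · linarith [h1.1, h1.2, h2'.1, h2'.2]

/-- **Fixed rational parameter.** For `c = q ∈ ℚ^×` fixed:
`|e·h_K(1/r + q·r^{m'}/(1-2x)) − (e+3)·h_K(x)| ≤ C(e,q)·[K:ℚ]` for every number field `K` and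
`x, r ∈ K` with `r^e = x(1-x)`, `x ∉ {0, 1, 1/2}` (`e ≥ 2`, `e + 1 = 2m'`) — the form consumed by
the `t_c`-family of GENELLTWO-P1ROUTE v2 §4 (`c ∈ ℚ^×`), since `h_K(q) = [K:ℚ]·h(q)`.
[cite: MochizukiGenEll2010, Prop 1.4 (i) p.6] -/
theorem exists_abs_logHeight₁_tFunC_sub_le_of_rat {e m' : ℕ} (he : 2 ≤ e) (hem : e + 1 = 2 * m')
    (q : ℚ) (hq : q ≠ 0) :
    ∃ C : ℝ, ∀ (K : Type) [Field K] [NumberField K] (x r : K), r ^ e = x * (1 - x) →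
      x ≠ 0 → x ≠ 1 → 1 - 2 * x ≠ 0 →
      |(e : ℝ) * logHeight₁ (r⁻¹ + (q : K) * (r ^ m' / (1 - 2 * x))) - (e + 3) * logHeight₁ x| ≤
        C * Module.finrank ℚ K := by
  obtain ⟨C, hC⟩ := exists_abs_logHeight₁_tFunC_sub_le he hem
  refine ⟨C + 3 * e * logHeight₁ q, fun K _ _ x r hr hx0 hx1 hs => ?_⟩
  have hqK : (q : K) ≠ 0 := by exact_mod_cast hq
  have h := hC K x r (q : K) hr hx0 hx1 hs hqK
  have hhq : logHeight₁ (q : K) = Module.finrank ℚ K * logHeight₁ q := by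
    rw [← eq_ratCast (algebraMap ℚ K) q]
    exact NumberField.logHeight₁_algebraMap q
  rw [hhq] at h
  calc _ ≤ C * Module.finrank ℚ K + 3 * e * (Module.finrank ℚ K * logHeight₁ q) := h
    _ = (C + 3 * e * logHeight₁ q) * Module.finrank ℚ K := by ring

/-- **Consumer shape** (`ht` of `FibreConductor.inv_finrank_mul_sum_logNorm_le_slope`, W5d): for
`e = 2k+1` (`k ≥ 1`), `m' = k+1` and fixed `c = q ∈ ℚ^×`,
`(2k+1)·h_L(1/r + q·r^{k+1}/(1-2x)) ≤ (2k+4)·h_L(x) + [L:ℚ]·C₄` on `r^{2k+1} = x(1-x)`, `x ∉ {0,1,1/2}`.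
[cite: MochizukiGenEll2010, Prop 1.4 (i) p.6] -/
theorem exists_tFunC_le_of_rat (k : ℕ) (hk : 1 ≤ k) (q : ℚ) (hq : q ≠ 0) :
    ∃ C₄ : ℝ, ∀ (L : Type) [Field L] [NumberField L] (x r : L), r ^ (2 * k + 1) = x * (1 - x) →
      x ≠ 0 → x ≠ 1 → 1 - 2 * x ≠ 0 →
      (2 * k + 1 : ℝ) * logHeight₁ (r⁻¹ + (q : L) * (r ^ (k + 1) / (1 - 2 * x))) ≤
        (2 * k + 4 : ℝ) * logHeight₁ x + Module.finrank ℚ L * C₄ := by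
  obtain ⟨C, hC⟩ := exists_abs_logHeight₁_tFunC_sub_le_of_rat (e := 2 * k + 1) (m' := k + 1)
    (by omega) (by omega) q hq
  refine ⟨C, fun L _ _ x r hr hx0 hx1 hs => ?_⟩
  have h := (abs_le.mp (hC L x r hr hx0 hx1 hs)).2
  push_cast at h
  linarith

end NumberField

end Superelliptic
end Literature.NumberTheory.DiophantineGeometry
end
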